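import Summits.HubbardSuperconductivity.HubbardSuperconductivity.Theorems.DeformationLadderLadderThesisNormalForms
import Literature.MathematicalPhysics.QuantumLattice.HubbardLSMFillingProofs
import Literature.MathematicalPhysics.QuantumLattice.PairFieldMomentum

/-!
# Route `DeformationLadder`, crux `LowEnergyRigidity` (`stmt-HubbardSuperconductivity-1892`):
# charge twists of the `d`-wave pair field and the Parseval weight bound

Support file (`--supports stmt-HubbardSuperconductivity-1892`) for the TWIST CEILING
`minEnergyOn (H_L + (s/L⁴)Δ_dᴴΔ_d) − minEnergyOn H_L ≤ C·s^{2/3}` on the `(N_L, S^z = 0)` sector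
(route `TwistGap`, item `TgTwistCeiling`), which through `penaltyGap_ge_of_groundState` caps every
witness of `LadderThesis` / `LowEnergyRigidity`. Its test states are the spin-`↑` CHARGE TWISTS
`U_θ ψ₀`, `U_θ = exp[i Σ_x θ(x) n_{x↑}] = fockTwist θ` (`HubbardLSMFillingProofs`) with
`θ(x) = 2π (q·x₁ mod L)/L`, `q ∈ ℤ/Lℤ`. This file bounds their pair WEIGHT:
* `pairField_eq_sum_spinUpGrouped`: `Δ_g = Σ_y B_y`, `B_y = Σ_e (g e/√2)(c_{y↑}c_{y+e,↓} − c_{y−e,↓}c_{y↑})`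
  (regrouping by the spin-`↑` site; no anticommutation used); `fockTwist_conj_spinUpGrouped`:
  `U_θ B_y U_θ⁻¹ = e^{−iθ(y↑)} B_y`; `norm_spinUpGrouped_le`: `‖B_y‖ ≤ 2Σ_e|g e/√2|` (`≤ 4√2`, `d`-wave);
* `sum_re_expect_fourierMode_le` (Parseval, `sum_conjTranspose_mul_fourierMode`): for `‖B_y‖ ≤ C₀`
  and `A(m) = Σ_y conj χ_m(y) B_y`, `Σ_m ⟨ψ, A(m)ᴴA(m)ψ⟩ ≤ C₀²L⁴` (unit `ψ`);
* `fockTwist_conj_pairField_eq_fourierMode`: `U_{±θ_q} Δ_g U_{±θ_q}⁻¹ = A(∓(q,0))`;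
* `sum_twistWeights_le`: for `2J < L` the `2J` twists `U_{±θ_j}`, `j = 1..J`, share ONE budget,
  `Σ_j (⟨U_{θ_j}ψ, Δ_dᴴΔ_d U_{θ_j}ψ⟩ + ⟨U_{−θ_j}ψ, Δ_dᴴΔ_d U_{−θ_j}ψ⟩) ≤ 32 L⁴` — the `1/J` gain
  behind the exponent `2/3`.

Sources: Lieb–Schultz–Mattis, Ann. Phys. 16 (1961) 407, App. B (twist); Oshikawa, PRL 84 (2000)
1535; Kennedy–Lieb–Shastry, PRL 61 (1988) 2582 (sum rule); Scalapino, Phys. Rep. 250 (1995) 329,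
§2. Finite-dimensional operator algebra on the Fock space of the `L × L` torus throughout.
-/

set_option linter.dupNamespace false

noncomputable section

namespace Summit.HubbardSuperconductivity.HubbardSuperconductivity.Theorems.DeformationLadder

open Matrix Complex Literature.MathematicalPhysics.QuantumLattice Literature.Probability.LatticeModels
  HubbardWave0
open scoped Matrix.Norms.L2Operator ComplexOrder ComplexConjugate

/-! ### Regrouping the pair field by the spin-`↑` site -/

section Grouped

variable (g : Site 2 → ℝ) (L : ℕ) [NeZero L]

/-- **Regrouping `Δ_g` by the spin-`↑` orbital.** `Δ_g = Σ_x Σ_e (g e/√2)(c_{x↑}c_{x+e,↓} − c_{x↓}c_{x+e,↑})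
= Σ_y B_y` with `B_y := Σ_e (g e/√2)(c_{y↑} c_{y+e,↓} − c_{y−e,↓} c_{y↑})`: in the second family
re-index `x = y − e`. No anticommutation relation is used. Scalapino, Phys. Rep. 250 (1995) 329,
§2, eq. (2.2). [folklore] -/
theorem pairField_eq_sum_spinUpGrouped :
    pairField g L = ∑ y : TorusSite 2 L, ∑ e ∈ insert (0 : Site 2) unitSteps,
      ((g e / Real.sqrt 2 : ℝ) : ℂ) •
        (annihilation (orb (FermionTorus.ofTorusSite y) 0) *
            annihilation (orb (FermionTorus.ofTorusSite (y + Torus.proj L e)) 1) -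
          annihilation (orb (FermionTorus.ofTorusSite (y - Torus.proj L e)) 1) *
            annihilation (orb (FermionTorus.ofTorusSite y) 0)) := by
  -- re-indexing `x = y - e` of the second family, for each step `e`
  have key : ∀ e : Site 2,
      (∑ x : TorusSite 2 L, ((g e / Real.sqrt 2 : ℝ) : ℂ) •
          (annihilation (orb (FermionTorus.ofTorusSite x) 1) *
            annihilation (orb (FermionTorus.ofTorusSite (x + Torus.proj L e)) 0))) =
        ∑ y : TorusSite 2 L, ((g e / Real.sqrt 2 : ℝ) : ℂ) •
          (annihilation (orb (FermionTorus.ofTorusSite (y - Torus.proj L e)) 1) *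
            annihilation (orb (FermionTorus.ofTorusSite y) 0)) := fun e =>
    Fintype.sum_equiv (Equiv.addRight (Torus.proj L e))
      (fun x : TorusSite 2 L => ((g e / Real.sqrt 2 : ℝ) : ℂ) •
        (annihilation (orb (FermionTorus.ofTorusSite x) 1) *
          annihilation (orb (FermionTorus.ofTorusSite (x + Torus.proj L e)) 0)))
      (fun y : TorusSite 2 L => ((g e / Real.sqrt 2 : ℝ) : ℂ) •
        (annihilation (orb (FermionTorus.ofTorusSite (y - Torus.proj L e)) 1) *
          annihilation (orb (FermionTorus.ofTorusSite y) 0)))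
      (fun x => by simp only [Equiv.coe_addRight, add_sub_cancel_right])
  unfold pairField localPair
  simp only [smul_sub, Finset.sum_sub_distrib]
  rw [Finset.sum_comm (s := (Finset.univ : Finset (TorusSite 2 L)))
      (f := fun x e => ((g e / Real.sqrt 2 : ℝ) : ℂ) •
        (annihilation (orb (FermionTorus.ofTorusSite x) 1) *
          annihilation (orb (FermionTorus.ofTorusSite (x + Torus.proj L e)) 0))),
    Finset.sum_comm (s := (Finset.univ : Finset (TorusSite 2 L)))
      (f := fun y e => ((g e / Real.sqrt 2 : ℝ) : ℂ) •
        (annihilation (orb (FermionTorus.ofTorusSite (y - Torus.proj L e)) 1) *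
          annihilation (orb (FermionTorus.ofTorusSite y) 0)))]
  simp only [key]

/-- **Covariance of `B_y` under a spin-`↑` twist.** If the twist angles vanish on the spin-`↓`
orbitals, `U_θ B_y U_θ⁻¹ = e^{−iθ(y↑)} B_y`: every term of `B_y` contains exactly one spin-`↑`
annihilator, located at `y` (`U_θ c_j U_θ⁻¹ = e^{−iθ_j} c_j`, `fockTwist_mul_annihilation_mul`).
Lieb–Schultz–Mattis, Ann. Phys. 16 (1961) 407, App. B. [folklore] -/
theorem fockTwist_conj_spinUpGrouped (θ : Orb (FermionTorus 2 L) → ℝ)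
    (hθ : ∀ x : FermionTorus 2 L, θ (orb x 1) = 0) (y : TorusSite 2 L) :
    fockTwist θ * (∑ e ∈ insert (0 : Site 2) unitSteps, ((g e / Real.sqrt 2 : ℝ) : ℂ) •
        (annihilation (orb (FermionTorus.ofTorusSite y) 0) *
            annihilation (orb (FermionTorus.ofTorusSite (y + Torus.proj L e)) 1) -
          annihilation (orb (FermionTorus.ofTorusSite (y - Torus.proj L e)) 1) *
            annihilation (orb (FermionTorus.ofTorusSite y) 0))) * fockTwist (-θ) =
      cexp (-((θ (orb (FermionTorus.ofTorusSite y) 0) : ℂ) * I)) •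
        ∑ e ∈ insert (0 : Site 2) unitSteps, ((g e / Real.sqrt 2 : ℝ) : ℂ) •
          (annihilation (orb (FermionTorus.ofTorusSite y) 0) *
              annihilation (orb (FermionTorus.ofTorusSite (y + Torus.proj L e)) 1) -
            annihilation (orb (FermionTorus.ofTorusSite (y - Torus.proj L e)) 1) *
              annihilation (orb (FermionTorus.ofTorusSite y) 0)) := by
  rw [Finset.mul_sum, Finset.sum_mul, Finset.smul_sum]
  refine Finset.sum_congr rfl fun e _ => ?_
  rw [Matrix.mul_smul, Matrix.smul_mul, Matrix.mul_sub, Matrix.sub_mul, fockTwist_conj_mul,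
    fockTwist_conj_mul θ (annihilation _) (annihilation (orb (FermionTorus.ofTorusSite y) 0)),
    fockTwist_mul_annihilation_mul, fockTwist_mul_annihilation_mul, fockTwist_mul_annihilation_mul,
    hθ, hθ]
  simp only [Complex.ofReal_zero, zero_mul, neg_zero, Complex.exp_zero, one_smul, smul_mul_assoc,
    mul_smul_comm, smul_sub, smul_smul]
  rw [mul_comm ((g e / Real.sqrt 2 : ℝ) : ℂ)]

/-- `‖c_a c_b − c_c c_d‖ ≤ 2` in operator norm (`‖c‖ ≤ 1`); generic orbital set, as in
`norm_bondPair_le_two`. [folklore] -/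
theorem norm_annihilation_mul_sub_le_two {Λ : Type*} [LinearOrder Λ] [Fintype Λ] (a b c d : Orb Λ) :
    ‖(annihilation a * annihilation b - annihilation c * annihilation d :
      Matrix (Finset (Orb Λ)) (Finset (Orb Λ)) ℂ)‖ ≤ 2 := by
  refine (norm_sub_le _ _).trans ?_
  have h : ∀ (i j : Orb Λ), ‖(annihilation i * annihilation j :
      Matrix (Finset (Orb Λ)) (Finset (Orb Λ)) ℂ)‖ ≤ 1 := fun i j =>
    (norm_mul_le _ _).trans
      (mul_le_one₀ (norm_annihilation_le_one _) (norm_nonneg _) (norm_annihilation_le_one _))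
  linarith [h a b, h c d]

/-- `‖B_y‖ ≤ 2 Σ_e |g e/√2|` (`‖c‖ ≤ 1`). [folklore] -/
theorem norm_spinUpGrouped_le (y : TorusSite 2 L) :
    ‖∑ e ∈ insert (0 : Site 2) unitSteps, ((g e / Real.sqrt 2 : ℝ) : ℂ) •
        (annihilation (orb (FermionTorus.ofTorusSite y) 0) *
            annihilation (orb (FermionTorus.ofTorusSite (y + Torus.proj L e)) 1) -
          annihilation (orb (FermionTorus.ofTorusSite (y - Torus.proj L e)) 1) *
            annihilation (orb (FermionTorus.ofTorusSite y) 0))‖ ≤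
      2 * ∑ e ∈ insert (0 : Site 2) unitSteps, |g e / Real.sqrt 2| := by
  rw [Finset.mul_sum]
  refine (norm_sum_le _ _).trans (Finset.sum_le_sum fun e _ => ?_)
  rw [norm_smul, Complex.norm_real, Real.norm_eq_abs, mul_comm]
  exact mul_le_mul_of_nonneg_right (norm_annihilation_mul_sub_le_two _ _ _ _) (abs_nonneg _)

/-- For the `d`-wave form factor, `‖B_y‖ ≤ 4√2`. [folklore] -/
theorem norm_spinUpGrouped_dWave_le (y : TorusSite 2 L) :
    ‖∑ e ∈ insert (0 : Site 2) unitSteps, ((dWaveFormFactor e / Real.sqrt 2 : ℝ) : ℂ) •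
        (annihilation (orb (FermionTorus.ofTorusSite y) 0) *
            annihilation (orb (FermionTorus.ofTorusSite (y + Torus.proj L e)) 1) -
          annihilation (orb (FermionTorus.ofTorusSite (y - Torus.proj L e)) 1) *
            annihilation (orb (FermionTorus.ofTorusSite y) 0))‖ ≤ 4 * Real.sqrt 2 := by
  refine (norm_spinUpGrouped_le dWaveFormFactor L y).trans ?_
  have h := sum_abs_dWaveFormFactor_div_sqrt_two_le
  linarith

end Grouped

/-! ### Parseval for operator-valued Fourier modes, in expectation -/

section Parseval

variable {L : ℕ} [NeZero L]

/-- `Re ⟨ψ, Bᴴ B ψ⟩ = ‖Bψ‖² ≤ ‖B‖²` for a unit vector `ψ`. [folklore] -/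
theorem re_expect_conjTranspose_mul_self_le {n : Type*} [Fintype n] [DecidableEq n]
    (B : Matrix n n ℂ) {ψ : n → ℂ} (hψ : star ψ ⬝ᵥ ψ = 1) :
    (star ψ ⬝ᵥ (Bᴴ * B) *ᵥ ψ).re ≤ ‖B‖ ^ 2 := by
  rw [← Literature.MathematicalPhysics.QuantumLattice.star_mulVec_dotProduct_mulVec, ← eucNorm_sq]
  have h1 : eucNorm (B *ᵥ ψ) ≤ ‖B‖ := by
    have h := eucNorm_mulVec_le B ψ
    rwa [eucNorm_eq_one hψ, mul_one] at h
  exact pow_le_pow_left₀ (eucNorm_nonneg _) h1 2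

/-- `Re ⟨ψ, Bᴴ B ψ⟩ = ‖Bψ‖² ≥ 0`. [folklore] -/
theorem re_expect_conjTranspose_mul_self_nonneg {n : Type*} [Fintype n]
    (B : Matrix n n ℂ) (ψ : n → ℂ) :
    0 ≤ (star ψ ⬝ᵥ (Bᴴ * B) *ᵥ ψ).re := by
  rw [← Literature.MathematicalPhysics.QuantumLattice.star_mulVec_dotProduct_mulVec]
  exact (Complex.nonneg_iff.1 (dotProduct_star_self_nonneg _)).1

/-- **Parseval weight budget.** For any family of operators `B_y`, `y ∈ (ℤ/Lℤ)²`, with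
`‖B_y‖ ≤ C₀` and the Fourier modes `A(m) = Σ_y conj χ_m(y) B_y`, every unit vector `ψ`
has `Σ_m Re⟨ψ, A(m)ᴴ A(m) ψ⟩ ≤ C₀²·L⁴`: by `sum_conjTranspose_mul_fourierMode`,
`Σ_m A(m)ᴴA(m) = L² Σ_y B_yᴴB_y`, and `Re⟨ψ, B_yᴴB_y ψ⟩ ≤ C₀²` for each of the `L²` sites.
Kennedy–Lieb–Shastry, PRL 61 (1988) 2582 (sum rule). [cite: KLS1988PRL, p. 2582] -/
theorem sum_re_expect_fourierMode_le
    (B : TorusSite 2 L → Matrix (Finset (Orb (FermionTorus 2 L))) (Finset (Orb (FermionTorus 2 L))) ℂ)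
    {C₀ : ℝ} (hB : ∀ y, ‖B y‖ ≤ C₀)
    {ψ : Fock (Orb (FermionTorus 2 L))} (hψ : star ψ ⬝ᵥ ψ = 1) :
    ∑ m : TorusSite 2 L, (star ψ ⬝ᵥ ((∑ y, conj (torusChar m y) • B y)ᴴ *
        (∑ y, conj (torusChar m y) • B y)) *ᵥ ψ).re ≤ C₀ ^ 2 * (L : ℝ) ^ 4 := by
  classical
  have hcard : Fintype.card (TorusSite 2 L) = L ^ 2 := by simp [TorusSite, ZMod.card]
  -- the operator Parseval identity, in expectation
  have h := congrArg (fun T => (star ψ ⬝ᵥ (T *ᵥ ψ)).re) (sum_conjTranspose_mul_fourierMode B)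
  simp only [Matrix.sum_mulVec, dotProduct_sum, Matrix.smul_mulVec, dotProduct_smul, smul_eq_mul,
    Complex.re_sum] at h
  have hL2 : ((L : ℂ) ^ 2) = (((L : ℝ) ^ 2 : ℝ) : ℂ) := by push_cast; ring
  rw [hL2, Complex.re_ofReal_mul, Complex.re_sum] at h
  rw [h]
  have hy : ∀ y : TorusSite 2 L, (star ψ ⬝ᵥ ((B y)ᴴ * B y) *ᵥ ψ).re ≤ C₀ ^ 2 := fun y =>
    (re_expect_conjTranspose_mul_self_le (B y) hψ).trans
      (pow_le_pow_left₀ (norm_nonneg _) (hB y) 2)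
  calc (L : ℝ) ^ 2 * ∑ y : TorusSite 2 L, (star ψ ⬝ᵥ ((B y)ᴴ * B y) *ᵥ ψ).re
      ≤ (L : ℝ) ^ 2 * ∑ _y : TorusSite 2 L, C₀ ^ 2 :=
        mul_le_mul_of_nonneg_left (Finset.sum_le_sum fun y _ => hy y) (by positivity)
    _ = C₀ ^ 2 * (L : ℝ) ^ 4 := by
        rw [Finset.sum_const, Finset.card_univ, hcard, nsmul_eq_mul]
        push_cast
        ring

end Parseval

/-! ### The twisted pair field is a Fourier mode; the shared weight budget -/

section Twist

variable (g : Site 2 → ℝ) {L : ℕ} [NeZero L]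

/-- The phase of the spin-`↑` charge twist at momentum `q ∈ ℤ/Lℤ` along `e₁` is a conjugate torus
character: `exp(−2πi (q·y₁ mod L)/L) = conj χ_{(q,0)}(y)`. [folklore] -/
theorem cexp_neg_twistPhase_eq_conj_torusChar (q : ZMod L) (y : TorusSite 2 L) :
    cexp (-(((2 * Real.pi * (((q * y 0).val : ℕ) : ℝ) / L : ℝ) : ℂ) * I)) =
      conj (torusChar (Pi.single (0 : Fin 2) q) y) := by
  rw [← exp_neg_dotProduct_eq_conj_torusChar]
  congr 1
  have hsum : (∑ i : Fin 2, (Pi.single (0 : Fin 2) q : TorusSite 2 L) i * y i) = q * y 0 := by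
    simp [Fin.sum_univ_two]
  rw [hsum]
  push_cast
  ring

/-- The opposite phase is the conjugate character of the opposite momentum:
`exp(+2πi (q·y₁ mod L)/L) = conj χ_{(−q,0)}(y)`. [folklore] -/
theorem cexp_twistPhase_eq_conj_torusChar_neg (q : ZMod L) (y : TorusSite 2 L) :
    cexp ((((2 * Real.pi * (((q * y 0).val : ℕ) : ℝ) / L : ℝ) : ℂ) * I)) =
      conj (torusChar (Pi.single (0 : Fin 2) (-q)) y) := by
  have h := congrArg conj (cexp_neg_twistPhase_eq_conj_torusChar q y)
  rw [← Complex.exp_conj, map_neg, map_mul, Complex.conj_ofReal, Complex.conj_I, mul_neg,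
    neg_neg] at h
  rw [h, Pi.single_neg, torusChar_comm (-Pi.single (0 : Fin 2) q), torusChar_neg_right,
    torusChar_comm]

/- The spin-`↑` CHARGE TWIST ANGLES at momentum `q ∈ ℤ/Lℤ` along `e₁`: `θ_q(x↑) = 2π (q·x₁ mod L)/L`,
`θ_q(x↓) = 0` — carried as a family `θ` with its defining equation `hθ`, so that statements stay
short; consumers instantiate `θ := fun q k => if (ofLex k).2 = 0 then … else 0`, `hθ := fun _ _ => rfl`.
(`q = 1`: the Lieb–Schultz–Mattis twist `lsmTwist L 0 0` of one spin species.) -/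
variable (θ : ZMod L → Orb (FermionTorus 2 L) → ℝ)
  (hθ : ∀ (q : ZMod L) (k : Orb (FermionTorus 2 L)), θ q k = if (ofLex k).2 = 0 then
    2 * Real.pi * ((((q * FermionTorus.toTorusSite (ofLex k).1 0).val : ℕ) : ℝ)) / L else 0)
include hθ

omit [NeZero L] in
/-- The twist angle vanishes on spin-`↓` orbitals. [folklore] -/
theorem twistAngle_apply_down (q : ZMod L) (x : FermionTorus 2 L) : θ q (orb x 1) = 0 := by
  rw [hθ]
  simp

/-- The twist angle on the spin-`↑` orbital of the site `y`: `θ_q(y↑) = 2π (q·y₁ mod L)/L`.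
[folklore] -/
theorem twistAngle_apply_up (q : ZMod L) (y : TorusSite 2 L) :
    θ q (orb (FermionTorus.ofTorusSite y) 0) = 2 * Real.pi * (((q * y 0).val : ℕ) : ℝ) / L := by
  rw [hθ]
  simp only [ofLex_toLex, FermionTorus.toTorusSite_ofTorusSite, if_true]

/-- **The twisted pair field is a Fourier mode**: `U_{θ_q} Δ_g U_{θ_q}⁻¹ = Σ_y conj χ_{(q,0)}(y) B_y`
with the regrouped operators `B_y` of `pairField_eq_sum_spinUpGrouped`.
Lieb–Schultz–Mattis (1961) App. B; Scalapino (1995) §2. [folklore] -/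
theorem fockTwist_conj_pairField_eq_fourierMode (q : ZMod L) :
    fockTwist (θ q) * pairField g L * fockTwist (-θ q) =
      ∑ y : TorusSite 2 L, conj (torusChar (Pi.single (0 : Fin 2) q) y) •
        ∑ e ∈ insert (0 : Site 2) unitSteps, ((g e / Real.sqrt 2 : ℝ) : ℂ) •
          (annihilation (orb (FermionTorus.ofTorusSite y) 0) *
              annihilation (orb (FermionTorus.ofTorusSite (y + Torus.proj L e)) 1) -
            annihilation (orb (FermionTorus.ofTorusSite (y - Torus.proj L e)) 1) *
              annihilation (orb (FermionTorus.ofTorusSite y) 0)) := by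
  rw [pairField_eq_sum_spinUpGrouped, Finset.mul_sum, Finset.sum_mul]
  refine Finset.sum_congr rfl fun y _ => ?_
  rw [fockTwist_conj_spinUpGrouped g L _ (twistAngle_apply_down θ hθ q) y,
    twistAngle_apply_up θ hθ, cexp_neg_twistPhase_eq_conj_torusChar q y]

/-- The oppositely twisted pair field is the mode of the opposite momentum:
`U_{θ_q}⁻¹ Δ_g U_{θ_q} = Σ_y conj χ_{(−q,0)}(y) B_y`. [folklore] -/
theorem fockTwist_neg_conj_pairField_eq_fourierMode (q : ZMod L) :
    fockTwist (-θ q) * pairField g L * fockTwist (θ q) =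
      ∑ y : TorusSite 2 L, conj (torusChar (Pi.single (0 : Fin 2) (-q)) y) •
        ∑ e ∈ insert (0 : Site 2) unitSteps, ((g e / Real.sqrt 2 : ℝ) : ℂ) •
          (annihilation (orb (FermionTorus.ofTorusSite y) 0) *
              annihilation (orb (FermionTorus.ofTorusSite (y + Torus.proj L e)) 1) -
            annihilation (orb (FermionTorus.ofTorusSite (y - Torus.proj L e)) 1) *
              annihilation (orb (FermionTorus.ofTorusSite y) 0)) := by
  rw [show fockTwist (θ q) = fockTwist (-(-θ q)) by rw [neg_neg], pairField_eq_sum_spinUpGrouped,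
    Finset.mul_sum, Finset.sum_mul]
  refine Finset.sum_congr rfl fun y _ => ?_
  rw [fockTwist_conj_spinUpGrouped g L (-θ q)
    (fun x => by rw [Pi.neg_apply, twistAngle_apply_down θ hθ, neg_zero]) y,
    Pi.neg_apply, twistAngle_apply_up θ hθ, Complex.ofReal_neg, neg_mul, neg_neg,
    cexp_twistPhase_eq_conj_torusChar_neg q y]

omit hθ in
/-- **Pair weight of a twisted state as a mode weight**: for `V = U_ϑ`,
`⟨Vψ, Δ_gᴴΔ_g Vψ⟩ = ⟨ψ, (V⁻¹Δ_gV)ᴴ(V⁻¹Δ_gV) ψ⟩`. [folklore] -/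
theorem re_expect_twisted_pairPenalty (ϑ : Orb (FermionTorus 2 L) → ℝ)
    (ψ : Fock (Orb (FermionTorus 2 L))) :
    (star (fockTwist ϑ *ᵥ ψ) ⬝ᵥ ((pairField g L)ᴴ * pairField g L) *ᵥ (fockTwist ϑ *ᵥ ψ)).re =
      (star ψ ⬝ᵥ ((fockTwist (-ϑ) * pairField g L * fockTwist ϑ)ᴴ *
        (fockTwist (-ϑ) * pairField g L * fockTwist ϑ)) *ᵥ ψ).re := by
  have hW : (fockTwist (-ϑ) * pairField g L * fockTwist ϑ)ᴴ =
      fockTwist (-ϑ) * (pairField g L)ᴴ * fockTwist ϑ := by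
    rw [conjTranspose_mul, conjTranspose_mul, conjTranspose_fockTwist, conjTranspose_fockTwist,
      neg_neg, Matrix.mul_assoc]
  have h1 : fockTwist (-ϑ) * ((pairField g L)ᴴ * pairField g L) * fockTwist ϑ =
      fockTwist (-ϑ) * (pairField g L)ᴴ * fockTwist ϑ *
        (fockTwist (-ϑ) * pairField g L * fockTwist ϑ) := by
    have h := fockTwist_conj_mul (-ϑ) (pairField g L)ᴴ (pairField g L)
    rw [neg_neg] at h
    exact h
  rw [Matrix.star_mulVec_dotProduct_mulVec, conjTranspose_fockTwist, h1, hW]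

/-- **Shared weight budget of the test twists.** For a unit vector `ψ` and `2·J < L`, the `2J`
states `U_{±θ_j}ψ`, `j = 1, …, J`, satisfy
`Σ_{j=1}^{J} (⟨U_{θ_j}ψ, Δ_dᴴΔ_d U_{θ_j}ψ⟩ + ⟨U_{−θ_j}ψ, Δ_dᴴΔ_d U_{−θ_j}ψ⟩) ≤ 32·L⁴`: the `2J`
twisted pair fields are the Fourier modes at the DISTINCT momenta `∓(j,0)` (`2J < L`), whose total
weight over all `L²` momenta is `≤ (4√2)²·L⁴` (`sum_re_expect_fourierMode_le`).
Kennedy–Lieb–Shastry, PRL 61 (1988) 2582; Lieb–Schultz–Mattis (1961) App. B. [folklore] -/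
theorem sum_twistWeights_le {ψ : Fock (Orb (FermionTorus 2 L))} (hψ : star ψ ⬝ᵥ ψ = 1)
    {J : ℕ} (hJ : 2 * J < L) :
    ∑ j ∈ Finset.Icc 1 J,
      ((star (fockTwist (θ j) *ᵥ ψ) ⬝ᵥ
          ((pairField dWaveFormFactor L)ᴴ * pairField dWaveFormFactor L) *ᵥ (fockTwist (θ j) *ᵥ ψ)).re +
        (star (fockTwist (-θ j) *ᵥ ψ) ⬝ᵥ
          ((pairField dWaveFormFactor L)ᴴ * pairField dWaveFormFactor L) *ᵥ (fockTwist (-θ j) *ᵥ ψ)).re)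
      ≤ 32 * (L : ℝ) ^ 4 := by
  classical
  -- the regrouped operators and their Fourier modes
  set B : TorusSite 2 L → Matrix (Finset (Orb (FermionTorus 2 L))) (Finset (Orb (FermionTorus 2 L))) ℂ :=
    fun y => ∑ e ∈ insert (0 : Site 2) unitSteps, ((dWaveFormFactor e / Real.sqrt 2 : ℝ) : ℂ) •
      (annihilation (orb (FermionTorus.ofTorusSite y) 0) *
          annihilation (orb (FermionTorus.ofTorusSite (y + Torus.proj L e)) 1) -
        annihilation (orb (FermionTorus.ofTorusSite (y - Torus.proj L e)) 1) *
          annihilation (orb (FermionTorus.ofTorusSite y) 0)) with hB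
  set F : TorusSite 2 L → ℝ := fun m => (star ψ ⬝ᵥ ((∑ y, conj (torusChar m y) • B y)ᴴ *
    (∑ y, conj (torusChar m y) • B y)) *ᵥ ψ).re with hF
  have hF0 : ∀ m, 0 ≤ F m := fun m => re_expect_conjTranspose_mul_self_nonneg _ ψ
  have hFsum : ∑ m, F m ≤ 32 * (L : ℝ) ^ 4 := by
    have h := sum_re_expect_fourierMode_le B (C₀ := 4 * Real.sqrt 2)
      (fun y => norm_spinUpGrouped_dWave_le L y) hψ
    have h32 : (4 * Real.sqrt 2) ^ 2 = 32 := by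
      rw [mul_pow, Real.sq_sqrt zero_le_two]; norm_num
    rwa [h32] at h
  -- each summand is a pair of mode weights
  have hterm : ∀ j : ℕ,
      (star (fockTwist (θ j) *ᵥ ψ) ⬝ᵥ
          ((pairField dWaveFormFactor L)ᴴ * pairField dWaveFormFactor L) *ᵥ (fockTwist (θ j) *ᵥ ψ)).re +
        (star (fockTwist (-θ j) *ᵥ ψ) ⬝ᵥ
          ((pairField dWaveFormFactor L)ᴴ * pairField dWaveFormFactor L) *ᵥ (fockTwist (-θ j) *ᵥ ψ)).re =
      F (Pi.single (0 : Fin 2) (-(j : ZMod L))) + F (Pi.single (0 : Fin 2) (j : ZMod L)) := by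
    intro j
    rw [re_expect_twisted_pairPenalty, re_expect_twisted_pairPenalty, neg_neg,
      fockTwist_neg_conj_pairField_eq_fourierMode dWaveFormFactor θ hθ,
      fockTwist_conj_pairField_eq_fourierMode dWaveFormFactor θ hθ]
  simp only [hterm, Finset.sum_add_distrib]
  -- the momenta `∓(j,0)`, `j = 1..J`, are pairwise distinct
  have hval : ∀ j ∈ Finset.Icc 1 J, ((j : ZMod L)).val = j := fun j hj =>
    ZMod.val_cast_of_lt (by have := (Finset.mem_Icc.1 hj).2; omega)
  have hinjP : Set.InjOn (fun j : ℕ => (Pi.single (0 : Fin 2) ((j : ZMod L)) : TorusSite 2 L))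
      (Finset.Icc 1 J) := by
    intro j₁ hj₁ j₂ hj₂ h
    have h' : ((j₁ : ZMod L)) = (j₂ : ZMod L) := (Pi.single_inj (0 : Fin 2)).1 h
    rw [← hval j₁ hj₁, ← hval j₂ hj₂, h']
  have hinjN : Set.InjOn (fun j : ℕ => (Pi.single (0 : Fin 2) (-(j : ZMod L)) : TorusSite 2 L))
      (Finset.Icc 1 J) := by
    intro j₁ hj₁ j₂ hj₂ h
    have h' : (-(j₁ : ZMod L)) = -(j₂ : ZMod L) := (Pi.single_inj (0 : Fin 2)).1 h
    rw [← hval j₁ hj₁, ← hval j₂ hj₂, neg_inj.1 h']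
  have hdisj : Disjoint
      ((Finset.Icc 1 J).image fun j : ℕ => (Pi.single (0 : Fin 2) (-(j : ZMod L)) : TorusSite 2 L))
      ((Finset.Icc 1 J).image fun j : ℕ => (Pi.single (0 : Fin 2) ((j : ZMod L)) : TorusSite 2 L)) := by
    rw [Finset.disjoint_left]
    intro m hm₁ hm₂
    obtain ⟨j₁, hj₁, rfl⟩ := Finset.mem_image.1 hm₁
    obtain ⟨j₂, hj₂, h⟩ := Finset.mem_image.1 hm₂
    have h' : ((j₂ : ZMod L)) = -(j₁ : ZMod L) := (Pi.single_inj (0 : Fin 2)).1 h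
    have hsum : ((j₂ + j₁ : ℕ) : ZMod L) = 0 := by push_cast; rw [h']; ring
    rw [ZMod.natCast_eq_zero_iff] at hsum
    have h1 := Finset.mem_Icc.1 hj₁
    have h2 := Finset.mem_Icc.1 hj₂
    exact absurd (Nat.le_of_dvd (by omega) hsum) (by omega)
  calc ∑ j ∈ Finset.Icc 1 J, F (Pi.single (0 : Fin 2) (-(j : ZMod L))) +
        ∑ j ∈ Finset.Icc 1 J, F (Pi.single (0 : Fin 2) (j : ZMod L))
      = ∑ m ∈ (Finset.Icc 1 J).image (fun j : ℕ => (Pi.single (0 : Fin 2) (-(j : ZMod L)) : TorusSite 2 L)), F m +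
        ∑ m ∈ (Finset.Icc 1 J).image (fun j : ℕ => (Pi.single (0 : Fin 2) ((j : ZMod L)) : TorusSite 2 L)), F m := by
        rw [Finset.sum_image hinjN, Finset.sum_image hinjP]
    _ = ∑ m ∈ (Finset.Icc 1 J).image (fun j : ℕ => (Pi.single (0 : Fin 2) (-(j : ZMod L)) : TorusSite 2 L)) ∪
          (Finset.Icc 1 J).image (fun j : ℕ => (Pi.single (0 : Fin 2) ((j : ZMod L)) : TorusSite 2 L)), F m := by
        rw [Finset.sum_union hdisj]
    _ ≤ ∑ m, F m := Finset.sum_le_univ_sum_of_nonneg hF0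
    _ ≤ 32 * (L : ℝ) ^ 4 := hFsum

end Twist

end Summit.HubbardSuperconductivity.HubbardSuperconductivity.Theorems.DeformationLadder
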